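import Summits.QuantumFields.BalabanUV.Beta.GAN24.RotatedVertexSlotInversionAllLevels
import Summits.QuantumFields.BalabanUV.Beta.GAN24.GaugeReadExitWard
import Summits.QuantumFields.BalabanUV.Beta.GAN24.GaugeReadChargeComb

/-!
# `BalabanUV.Beta.GAN24.SigmaPairSlotMomentsExit` — binder row G-an2-4 ∕ (CONV-C), the (S) row of RULING R-gan24p1-g27-1 PART B (viii) («(INV)_{α+γ} := (INV-X-geo) ∘ (W-γ)»):
# **THE ASSEMBLY.  At every level `k`, (W-γ)_k ALONE ⇒ (M0) ∧ (Π) for the exit⊗exit charge profile of the σ-PAIR `(α) + (γ)` of the residual tower's first-order data;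
# AT LEVEL 0 — where leaf-06 g47 FILE F supplies (W-γ) — WITH NO DISPLAYED HYPOTHESIS** (centred root, `Lc` odd, the tower's pin `cE = Lc^{d+1}`, all `cVH cΛ`, `α ≠ β`)
# (G-an2-4 formalisation swarm → CRUX TEAM (2), seat `b2b-balaban-gan24-formalise-leaf-02`, gen 59; sequel of `RotatedVertexSlotInversionAllLevels`)

NOT IN PRINT; OUR BOOKKEEPING ([folklore] composition BY NAME: the OWNER gan24-p1 g27's `SlotMomentParity.tsum_mul_eq_zero_of_involutive ∕ coord_slotInv ∕ summable_of_envelope ∕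
summable_slotMoment_of_envelope`, road-P2 g38∕g39's `WardResidualRotatedVertexInversion.slotInv_of_geo_of_ward`, `WardResidualRotatedVertexPeriodic.hasSum_totalCharge_of_periodic ∕
hasSum_slotMoment_of_periodic`, `WardResidualRotatedVertexWeighted.weightedCharge_SpureRecAt_block ∕ weightedCharge_M1At_const ∕ hasSum_weighted_vertexOfK`, leaf-06 g45∕g47's
`GaugeReadChargeComb.exists_envelope_comb_gaugeCharge ∕ hasSum_comb_gaugeCharge_mass_zero` and `GaugeReadExitWard.gaugeCharge_exit_eq_two_mul_cE_mul_rotatedVertexEnd` (FILE F), this seat's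
`RotatedVertexSlotInversionAllLevels.weightedProfile_comb_slotInv_ctr_exit_level`; 0 `def`, 0 cited fact, 0 `def … : Prop`, 0 sorry).  HONEST FRAMING (cell contract, verbatim):
«discharging `BetaPertH` makes Bałaban's UV stability UNCONDITIONAL — a real constructive-QFT result; it is NOT the continuum limit and NOT the Clay problem.»  HONEST DEPENDENCY
(verbatim): «continuum YM on T⁴ ⇐ BetaPertH ∧ nine spine estimates (0/9 proved); BetaPertH ⇐ (D1) ∧ (D4) ∧ CAP+tail; G-an2-4 gates asym, D1 and NE2/3/4.»

THE OBJECTS (generic `d`; centred root `ρ = toSite (ctrOff (d+1) Lc)`; level `k ≥ 0`; `G_k = coDressKBmAt ρ Lc (KInvStep Lc k)`, `S_k = SpureRecAt … k`, `M_k = M1At … k`,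
`cH_k = (stepScale_k·Lc^{d+1})⁻¹`).  The level-`k` first-order data of road-P2's residual tower (`WardResidualSRecursion.divW_WrecAt_succ_vertexForm` at `k = j+1`; the base of
`WardResidualSRecursionAll.exists_kernelLaws_vertexForm` ∕ `residual_eq_vertexForm₀` at `k = 0`) carry, besides `vertexOfM G_k (RM y)`, the σ-PAIR
`½ • (dM (conjV G_k X_y) Lc S_k M_k ν y′ − cH_k • gauge-read_k(y; ν, y′))` = (α)_y + (γ)_y.  For the weight `ω = 𝟙^{exit}_α ⊗ 𝟙^{exit}_β` in the channel `(inl α, inl β)` its ω-charge per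
slot `(ν, y′)` is `Z_k(y′) = Vα_k(y′) − ½·cH_k·Q^{comb}_k(y′)`: `Vα_k` = the BASE-POINT profile of (α) (`RotatedVertexSlotInversionAllLevels.hasSum_weighted_rotatedVertex_comb_level`; road-P2 g38
at `k = j+1`), `Q^{comb}_k` = leaf-06's (γ) profile of the literal response `G_k ∘ dM G_k Lc S_k M_k ν y′` (`GaugeReadChargeComb`'s shape), `V⁺_k` = the END-POINT profile.
* §1 the exit weight (bounded, jointly `Lc`-periodic); §2 the (α) side at level `k` BY NAME: `hasSum_baseProfile_exit_level` ((M0)_α), `summable_slotMoment_baseProfile_exit_level`.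
* §3 **`moments_sigmaPair_exit_of_ward_level`** — THE ASSEMBLY AT LEVEL `k` (centred root, `Lc` odd, all `cE cVH cΛ`, every `α β ν y`): the ONE displayed hypothesis is (W-γ)_k in
  FILE F's value form «`Q^{comb}_k(y′) = 2·(stepScale_k·Lc^{d+1})·V⁺_k(y′)`» (`k = 0` on the pin: FILE F's `2·cE·V⁺`; `k = j+1`: road-P2 g43 INTENT 1∕2 + leaf-06 g48, in flight);
  CONCLUSION `Σ' Z_k = 0 ∧ ∀ λ, Σ' (y′ − y)_λ·Z_k(y′) = 0` — (M0) ∧ (Π) for the σ-pair (the `hM0 ∕ hP1` sockets of leaf-01's (LT-3) `LayerPushMoments.abs_tsum_mul_le_of_moments` for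
  this piece).  Mechanism: (INV-X-geo)_k (this seat, hypothesis-free) ∧ (W-γ)_k ⇒ `Z_k ∘ σ_ν = Z_k` (`slotInv_of_geo_of_ward`, `ε = −1`); (M0)_α (road-P2) + (M0)_γ (leaf-06);
  summable moments (road-P2's closed form, leaf-06's envelope); the OWNER's one-involution lemma.
* §4 **`moments_sigmaPair_exit_levelZero`** ∕ **`tsum_slotMoment_sigmaPair_exit_levelZero`** (literal) — LEVEL 0 WITH NO DISPLAYED HYPOTHESIS: `cE = Lc^{d+1}` (the residual
  tower's own pin), `α ≠ β`, all `cVH cΛ`, every `y ν λ`: `Σ' Z₀ = 0 ∧ Σ' (y′ − y)_λ·Z₀(y′) = 0` — FILE F discharges (W-γ)₀ (`stepScale_0 = 1`).  THE (S) ROW IS A THEOREM AT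
  LEVEL 0 for the exit⊗exit σ-pair.
WHAT THIS FILE DOES NOT DO.  (W-γ)_k for `k ≥ 1` stays DISPLAYED (road-P2 ∕ leaf-06); plain⊗exit ∕ plain⊗plain, `α = β`, off-centre roots, and the other pieces of the first-order
data (`vertexOfM G_k (RM y)`, the table-law letters) are NOT treated; asserts NO value of Bałaban's tables; discharges NOTHING of (Q-R) ∕ (DL) ∕ (LT) ∕ (Q-L) ∕ (C) ∕ «T2Shape» ∕
(hW, hWall); NEVER «G-an2-4 closed» as (CONV-C); NOT D1, NOT `BetaPertH`, NOT continuum, NOT Clay.  2026-08-22; no existing file touched.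
-/

noncomputable section

open Finset
open scoped BigOperators
open Literature.MathematicalPhysics.QuantumFieldTheory
open Literature.MathematicalPhysics.QuantumFieldTheory.Balaban1983to89
open Literature.MathematicalPhysics.QuantumFieldTheory.Balaban1983to89.Beta
open B12Sec2to5 (l1)
open ExpKernelCalculus (Site MKer comp)
open AffineAveraging (box toSite)
open AveragingContours (blk)
open AveragingContoursRooted (ctrOff ctrOff_mem_box)
open OneStepResolventKernel (Fib)
open OneStepKernelFamily (KInvStep colH abs_colH_le)
open SecondOrderResponse (colM dM)
open Summit.QuantumFields.BalabanUV.Beta.BorderedHessian (stepScale)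
open Summit.QuantumFields.BalabanUV.Beta.AxialDressingRooted (coDressKBmAt decays_coDressKBmAt_KInvStep)
open Summit.QuantumFields.BalabanUV.Beta.SpineRooted (SpureRecAt M1At locStencil_SpureRecAt)
open Summit.QuantumFields.BalabanUV.Beta.KernelWardRelative (gaugeWt)
open Summit.QuantumFields.BalabanUV.Beta.GAN24.SlotMomentParity (tsum_mul_eq_zero_of_involutive coord_slotInv summable_of_envelope summable_slotMoment_of_envelope)
open Summit.QuantumFields.BalabanUV.Beta.GAN24.WardResidualRotatedVertexWeighted (hasSum_weighted_vertexOfK weightedCharge_SpureRecAt_block weightedCharge_M1At_const)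
open Summit.QuantumFields.BalabanUV.Beta.GAN24.WardResidualRotatedVertexPeriodic (hasSum_totalCharge_of_periodic hasSum_slotMoment_of_periodic)
open Summit.QuantumFields.BalabanUV.Beta.GAN24.WardResidualRotatedVertexInversion (slotInv_of_geo_of_ward)
open Summit.QuantumFields.BalabanUV.Beta.GAN24.GaugeReadChargeComb (exists_envelope_comb_gaugeCharge hasSum_comb_gaugeCharge_mass_zero)
open Summit.QuantumFields.BalabanUV.Beta.GAN24.GaugeReadExitWard (gaugeCharge_exit_eq_two_mul_cE_mul_rotatedVertexEnd)
open Summit.QuantumFields.BalabanUV.Beta.GAN24.RotatedVertexSlotInversionAllLevels (weightedProfile_comb_slotInv_ctr_exit_level)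

namespace Summit.QuantumFields.BalabanUV.Beta.GAN24.SigmaPairSlotMomentsExit

variable {d : ℕ} {Lc : ℕ} [NeZero Lc]

/-! ## §1 The exit⊗exit weight -/

omit [NeZero Lc] in
/-- [folklore] `|𝟙^{exit}_α(x)·𝟙^{exit}_β(z)| ≤ 1`. -/
theorem abs_exitWt_le_one (α β : Fin (d + 1)) (xz : Site (d + 1) × Site (d + 1)) :
    |(if xz.1 α % (Lc : ℤ) = (Lc : ℤ) - 1 then (1 : ℝ) else 0) * (if xz.2 β % (Lc : ℤ) = (Lc : ℤ) - 1 then (1 : ℝ) else 0)| ≤ 1 := by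
  rw [abs_mul]
  have h1 : |(if xz.1 α % (Lc : ℤ) = (Lc : ℤ) - 1 then (1 : ℝ) else 0)| ≤ 1 := by split_ifs <;> simp
  have h2 : |(if xz.2 β % (Lc : ℤ) = (Lc : ℤ) - 1 then (1 : ℝ) else 0)| ≤ 1 := by split_ifs <;> simp
  exact (mul_le_mul h1 h2 (abs_nonneg _) zero_le_one).trans (le_of_eq (one_mul 1))

omit [NeZero Lc] in
/-- [folklore] The exit⊗exit weight is jointly `Lc`-periodic: `ω(x + Lc•s, z + Lc•s) = ω(x, z)`. -/
theorem exitWt_periodic (α β : Fin (d + 1)) (s : Site (d + 1)) (xz : Site (d + 1) × Site (d + 1)) :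
    (if (xz.1 + (Lc : ℤ) • s) α % (Lc : ℤ) = (Lc : ℤ) - 1 then (1 : ℝ) else 0) * (if (xz.2 + (Lc : ℤ) • s) β % (Lc : ℤ) = (Lc : ℤ) - 1 then (1 : ℝ) else 0)
      = (if xz.1 α % (Lc : ℤ) = (Lc : ℤ) - 1 then (1 : ℝ) else 0) * (if xz.2 β % (Lc : ℤ) = (Lc : ℤ) - 1 then (1 : ℝ) else 0) := by
  have e1 : (xz.1 + (Lc : ℤ) • s) α % (Lc : ℤ) = xz.1 α % (Lc : ℤ) := by
    rw [Pi.add_apply, Pi.smul_apply, smul_eq_mul, Int.add_mul_emod_self_left]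
  have e2 : (xz.2 + (Lc : ℤ) • s) β % (Lc : ℤ) = xz.2 β % (Lc : ℤ) := by
    rw [Pi.add_apply, Pi.smul_apply, smul_eq_mul, Int.add_mul_emod_self_left]
  rw [e1, e2]

/-! ## §2 The (α) side at level `k` BY NAME: zero mass and summable slot moments of the BASE-POINT profile -/

/-- NOT IN PRINT; OUR BOOKKEEPING.  **(M0)_α AT LEVEL `k` FOR THE EXIT CLASS** (any in-block root, all `cE cVH cΛ`, every `k y ν α β`): the BASE-POINT profile `Vα_k` of
`(α)_y = ½ • dM (conjV G_k X_y) Lc S_k M_k` has `HasSum … 0` over the slots — road-P2's `hasSum_totalCharge_of_periodic` (`weightedCharge_SpureRecAt_block`, `weightedCharge_M1At_const`,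
`hasSum_weighted_vertexOfK`); road-P2 g38 `hasSum_totalCharge_weighted_comb` is the member `k = j+1`. -/
theorem hasSum_baseProfile_exit_level (hLc : 1 ≤ Lc) {r : Fin (d + 1) → ℕ} (hr : r ∈ box (d + 1) Lc) (cE cVH cΛ : ℝ) (k : ℕ) (y : Site (d + 1))
    (ν α β : Fin (d + 1)) :
    HasSum (fun y' : Site (d + 1) =>
        (1 / 2 : ℝ) *
          ((∑ κ : Fin (d + 1), ∑' u : Site (d + 1),
              colH (coDressKBmAt (toSite r) Lc (KInvStep (d := d) Lc k)) Lc ν y' κ u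
                * ((if y' = y then (1 / 2 : ℝ) else 0) - (if blk Lc u = y then (1 / 2 : ℝ) else 0))
                * ∑' xz : Site (d + 1) × Site (d + 1),
                    ((if xz.1 α % (Lc : ℤ) = (Lc : ℤ) - 1 then (1 : ℝ) else 0) * (if xz.2 β % (Lc : ℤ) = (Lc : ℤ) - 1 then (1 : ℝ) else 0))
                      * SpureRecAt d Lc (toSite r) cE cVH cΛ k κ u xz.1 xz.2 (Sum.inl α) (Sum.inl β))
            + ∑ ρ' : Fin (d + 1), ∑' w : Site (d + 1),
              colM (coDressKBmAt (toSite r) Lc (KInvStep (d := d) Lc k)) Lc ν y' ρ' w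
                * ((if y' = y then (1 / 2 : ℝ) else 0) - (if w = y then (1 / 2 : ℝ) else 0))
                * ∑' xz : Site (d + 1) × Site (d + 1),
                    ((if xz.1 α % (Lc : ℤ) = (Lc : ℤ) - 1 then (1 : ℝ) else 0) * (if xz.2 β % (Lc : ℤ) = (Lc : ℤ) - 1 then (1 : ℝ) else 0))
                      * M1At d Lc (toSite r) cΛ k ρ' w xz.1 xz.2 (Sum.inl α) (Sum.inl β))) 0 := by
  obtain ⟨δG, CG, hδG, hCG, hG⟩ := decays_coDressKBmAt_KInvStep (d := d) hr k
  obtain ⟨Cs, δs, hδs, hS⟩ := locStencil_SpureRecAt (d := d) (Lc := Lc) hLc hr cE cVH cΛ k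
  have hω := abs_exitWt_le_one (Lc := Lc) (d := d) α β
  have hωp := exitWt_periodic (Lc := Lc) (d := d) α β
  exact hasSum_totalCharge_of_periodic hLc hr k ν y
    (fun κ t v => weightedCharge_SpureRecAt_block hLc (toSite r) cE cVH cΛ k (Sum.inl α) (Sum.inl β) hωp κ t v)
    (fun κ => (hasSum_weighted_vertexOfK (c₀ := (Lc : ℤ) • y) ν y (fun κ t => abs_colH_le (N := Lc) hG ν y κ t) hδG hS hδs (Sum.inl α) (Sum.inl β) hω).2 κ)
    (fun ρ' w => weightedCharge_M1At_const (toSite r) cΛ k (Sum.inl α) (Sum.inl β) hωp ρ' w y)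

/-- NOT IN PRINT; OUR BOOKKEEPING.  **THE FIRST SLOT-MOMENTS OF `Vα_k` ARE SUMMABLE** (road-P2's closed form `hasSum_slotMoment_of_periodic`, in the weight `(y′ − y)_λ`). -/
theorem summable_slotMoment_baseProfile_exit_level (hLc : 1 ≤ Lc) {r : Fin (d + 1) → ℕ} (hr : r ∈ box (d + 1) Lc) (cE cVH cΛ : ℝ) (k : ℕ) (y : Site (d + 1))
    (ν α β lam : Fin (d + 1)) :
    Summable (fun y' : Site (d + 1) => (((y' - y) lam : ℤ) : ℝ) *
        ((1 / 2 : ℝ) *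
          ((∑ κ : Fin (d + 1), ∑' u : Site (d + 1),
              colH (coDressKBmAt (toSite r) Lc (KInvStep (d := d) Lc k)) Lc ν y' κ u
                * ((if y' = y then (1 / 2 : ℝ) else 0) - (if blk Lc u = y then (1 / 2 : ℝ) else 0))
                * ∑' xz : Site (d + 1) × Site (d + 1),
                    ((if xz.1 α % (Lc : ℤ) = (Lc : ℤ) - 1 then (1 : ℝ) else 0) * (if xz.2 β % (Lc : ℤ) = (Lc : ℤ) - 1 then (1 : ℝ) else 0))
                      * SpureRecAt d Lc (toSite r) cE cVH cΛ k κ u xz.1 xz.2 (Sum.inl α) (Sum.inl β))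
            + ∑ ρ' : Fin (d + 1), ∑' w : Site (d + 1),
              colM (coDressKBmAt (toSite r) Lc (KInvStep (d := d) Lc k)) Lc ν y' ρ' w
                * ((if y' = y then (1 / 2 : ℝ) else 0) - (if w = y then (1 / 2 : ℝ) else 0))
                * ∑' xz : Site (d + 1) × Site (d + 1),
                    ((if xz.1 α % (Lc : ℤ) = (Lc : ℤ) - 1 then (1 : ℝ) else 0) * (if xz.2 β % (Lc : ℤ) = (Lc : ℤ) - 1 then (1 : ℝ) else 0))
                      * M1At d Lc (toSite r) cΛ k ρ' w xz.1 xz.2 (Sum.inl α) (Sum.inl β)))) := by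
  have hωp := exitWt_periodic (Lc := Lc) (d := d) α β
  have h := (hasSum_slotMoment_of_periodic hLc hr k ν lam y
    (ZS := fun κ u => ∑' xz : Site (d + 1) × Site (d + 1),
         ((if xz.1 α % (Lc : ℤ) = (Lc : ℤ) - 1 then (1 : ℝ) else 0) * (if xz.2 β % (Lc : ℤ) = (Lc : ℤ) - 1 then (1 : ℝ) else 0))
           * SpureRecAt d Lc (toSite r) cE cVH cΛ k κ u xz.1 xz.2 (Sum.inl α) (Sum.inl β))
    (ZM := fun ρ' w => ∑' xz : Site (d + 1) × Site (d + 1),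
         ((if xz.1 α % (Lc : ℤ) = (Lc : ℤ) - 1 then (1 : ℝ) else 0) * (if xz.2 β % (Lc : ℤ) = (Lc : ℤ) - 1 then (1 : ℝ) else 0))
           * M1At d Lc (toSite r) cΛ k ρ' w xz.1 xz.2 (Sum.inl α) (Sum.inl β))
    (fun κ t v => weightedCharge_SpureRecAt_block hLc (toSite r) cE cVH cΛ k (Sum.inl α) (Sum.inl β) hωp κ t v)
    (fun ρ' w => weightedCharge_M1At_const (toSite r) cΛ k (Sum.inl α) (Sum.inl β) hωp ρ' w 0)).summable
  refine h.congr fun y' => ?_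
  simp only [Pi.sub_apply, Int.cast_sub]

/-! ## §3 The assembly at level `k`: (INV-X-geo)_k (this seat, hypothesis-free) ∧ (W-γ)_k (displayed) ⇒ (M0) ∧ (Π) for the σ-pair -/

/-- NOT IN PRINT; OUR BOOKKEEPING.  **THE (S) ROW FOR THE EXIT⊗EXIT σ-PAIR AT LEVEL `k`, MODULO (W-γ)_k ALONE** (centred root, `Lc` odd, all `cE cVH cΛ`, every `k y ν α β`).
The three profiles are bound by their DEFINING EQUATIONS `hVα ∕ hVend ∕ hQc` (instantiate with `fun _ => rfl`): `Vα` = the BASE-POINT profile of `(α)_y = ½ • dM (conjV G_k X_y) Lc S_k M_k`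
(value of `RotatedVertexSlotInversionAllLevels.hasSum_weighted_rotatedVertex_comb_level`), `Vend` = the END-POINT profile, `Qc` = leaf-06's (γ) profile of `G_k ∘ dM G_k Lc S_k M_k ν y′`.
IF (W-γ)_k «`∀ y′, Qc y′ = 2·(stepScale_k·Lc^{d+1})·Vend y′`» THEN `Z_k(y′) = Vα y′ − ½·(stepScale_k·Lc^{d+1})⁻¹·Qc y′` — the ω-charge of the σ-pair
`½ • (dM (conjV G_k X_y) Lc S_k M_k − cH_k • gauge-read_k)` at the slot `(ν, y′)` — has ZERO MASS and ZERO FIRST SLOT-MOMENTS about `y` in EVERY direction ((INV-X-geo)_k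
`weightedProfile_comb_slotInv_ctr_exit_level` + (W-γ)_k ⇒ `Z_k ∘ σ_ν = Z_k` by `slotInv_of_geo_of_ward`, `ε = −1`; (M0)_α §2 + (M0)_γ leaf-06; the OWNER's `tsum_mul_eq_zero_of_involutive`). -/
theorem moments_sigmaPair_exit_of_ward_level (hLc : Odd Lc) (cE cVH cΛ : ℝ) (k : ℕ) (y : Site (d + 1)) (ν α β : Fin (d + 1))
    {Vα Vend Qc : Site (d + 1) → ℝ}
    (hVα : ∀ y' : Site (d + 1), Vα y' =
        (1 / 2 : ℝ) *
          ((∑ κ : Fin (d + 1), ∑' u : Site (d + 1),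
              colH (coDressKBmAt (toSite (ctrOff (d + 1) Lc)) Lc (KInvStep (d := d) Lc k)) Lc ν y' κ u
                * ((if y' = y then (1 / 2 : ℝ) else 0) - (if blk Lc u = y then (1 / 2 : ℝ) else 0))
                * ∑' xz : Site (d + 1) × Site (d + 1),
                    ((if xz.1 α % (Lc : ℤ) = (Lc : ℤ) - 1 then (1 : ℝ) else 0) * (if xz.2 β % (Lc : ℤ) = (Lc : ℤ) - 1 then (1 : ℝ) else 0))
                      * SpureRecAt d Lc (toSite (ctrOff (d + 1) Lc)) cE cVH cΛ k κ u xz.1 xz.2 (Sum.inl α) (Sum.inl β))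
            + ∑ ρ' : Fin (d + 1), ∑' w : Site (d + 1),
              colM (coDressKBmAt (toSite (ctrOff (d + 1) Lc)) Lc (KInvStep (d := d) Lc k)) Lc ν y' ρ' w
                * ((if y' = y then (1 / 2 : ℝ) else 0) - (if w = y then (1 / 2 : ℝ) else 0))
                * ∑' xz : Site (d + 1) × Site (d + 1),
                    ((if xz.1 α % (Lc : ℤ) = (Lc : ℤ) - 1 then (1 : ℝ) else 0) * (if xz.2 β % (Lc : ℤ) = (Lc : ℤ) - 1 then (1 : ℝ) else 0))
                      * M1At d Lc (toSite (ctrOff (d + 1) Lc)) cΛ k ρ' w xz.1 xz.2 (Sum.inl α) (Sum.inl β)))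
    (hVend : ∀ y' : Site (d + 1), Vend y' =
        (1 / 2 : ℝ) *
          ((∑ κ : Fin (d + 1), ∑' u : Site (d + 1),
              colH (coDressKBmAt (toSite (ctrOff (d + 1) Lc)) Lc (KInvStep (d := d) Lc k)) Lc ν y' κ u
                * ((if y' + Pi.single ν 1 = y then (1 / 2 : ℝ) else 0) - (if blk Lc (u + Pi.single κ 1) = y then (1 / 2 : ℝ) else 0))
                * ∑' xz : Site (d + 1) × Site (d + 1),
                    ((if xz.1 α % (Lc : ℤ) = (Lc : ℤ) - 1 then (1 : ℝ) else 0) * (if xz.2 β % (Lc : ℤ) = (Lc : ℤ) - 1 then (1 : ℝ) else 0))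
                      * SpureRecAt d Lc (toSite (ctrOff (d + 1) Lc)) cE cVH cΛ k κ u xz.1 xz.2 (Sum.inl α) (Sum.inl β))
            + ∑ ρ' : Fin (d + 1), ∑' w : Site (d + 1),
              colM (coDressKBmAt (toSite (ctrOff (d + 1) Lc)) Lc (KInvStep (d := d) Lc k)) Lc ν y' ρ' w
                * ((if y' + Pi.single ν 1 = y then (1 / 2 : ℝ) else 0) - (if w + Pi.single ρ' 1 = y then (1 / 2 : ℝ) else 0))
                * ∑' xz : Site (d + 1) × Site (d + 1),
                    ((if xz.1 α % (Lc : ℤ) = (Lc : ℤ) - 1 then (1 : ℝ) else 0) * (if xz.2 β % (Lc : ℤ) = (Lc : ℤ) - 1 then (1 : ℝ) else 0))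
                      * M1At d Lc (toSite (ctrOff (d + 1) Lc)) cΛ k ρ' w xz.1 xz.2 (Sum.inl α) (Sum.inl β)))
    (hQc : ∀ y' : Site (d + 1), Qc y' =
        (∑ κ : Fin (d + 1), ∑' u : Site (d + 1),
            (∑' x₂, ∑ κ₂, comp (coDressKBmAt (toSite (ctrOff (d + 1) Lc)) Lc (KInvStep (d := d) Lc k))
                (dM (coDressKBmAt (toSite (ctrOff (d + 1) Lc)) Lc (KInvStep (d := d) Lc k)) Lc (SpureRecAt d Lc (toSite (ctrOff (d + 1) Lc)) cE cVH cΛ k) (M1At d Lc (toSite (ctrOff (d + 1) Lc)) cΛ k) ν y')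
                u x₂ (Sum.inl κ) (Sum.inl κ₂) * gaugeWt Lc y κ₂ x₂)
              * ∑' xz : Site (d + 1) × Site (d + 1),
                  ((if xz.1 α % (Lc : ℤ) = (Lc : ℤ) - 1 then (1 : ℝ) else 0) * (if xz.2 β % (Lc : ℤ) = (Lc : ℤ) - 1 then (1 : ℝ) else 0))
                    * SpureRecAt d Lc (toSite (ctrOff (d + 1) Lc)) cE cVH cΛ k κ u xz.1 xz.2 (Sum.inl α) (Sum.inl β)
          + ∑ ρ' : Fin (d + 1), ∑' w : Site (d + 1),
            (∑' x₂, ∑ κ₂, comp (coDressKBmAt (toSite (ctrOff (d + 1) Lc)) Lc (KInvStep (d := d) Lc k))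
                (dM (coDressKBmAt (toSite (ctrOff (d + 1) Lc)) Lc (KInvStep (d := d) Lc k)) Lc (SpureRecAt d Lc (toSite (ctrOff (d + 1) Lc)) cE cVH cΛ k) (M1At d Lc (toSite (ctrOff (d + 1) Lc)) cΛ k) ν y')
                ((Lc : ℤ) • w) x₂ (Sum.inr ρ') (Sum.inl κ₂) * gaugeWt Lc y κ₂ x₂)
              * ∑' xz : Site (d + 1) × Site (d + 1),
                  ((if xz.1 α % (Lc : ℤ) = (Lc : ℤ) - 1 then (1 : ℝ) else 0) * (if xz.2 β % (Lc : ℤ) = (Lc : ℤ) - 1 then (1 : ℝ) else 0))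
                    * M1At d Lc (toSite (ctrOff (d + 1) Lc)) cΛ k ρ' w xz.1 xz.2 (Sum.inl α) (Sum.inl β)))
    (hW : ∀ y' : Site (d + 1), Qc y' = 2 * (stepScale d Lc k * (Lc : ℝ) ^ (d + 1)) * Vend y') :
    (∑' y' : Site (d + 1), (Vα y' - (1 / 2 : ℝ) * (stepScale d Lc k * (Lc : ℝ) ^ (d + 1))⁻¹ * Qc y') = 0)
      ∧ ∀ lam : Fin (d + 1),
        ∑' y' : Site (d + 1), (((y' - y) lam : ℤ) : ℝ) * (Vα y' - (1 / 2 : ℝ) * (stepScale d Lc k * (Lc : ℝ) ^ (d + 1))⁻¹ * Qc y') = 0 := by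
  have hLc1 : 1 ≤ Lc := hLc.pos
  have hr : ctrOff (d + 1) Lc ∈ box (d + 1) Lc := ctrOff_mem_box hLc1
  have eVα : Vα = fun y' => (1 / 2 : ℝ) *
        ((∑ κ : Fin (d + 1), ∑' u : Site (d + 1),
            colH (coDressKBmAt (toSite (ctrOff (d + 1) Lc)) Lc (KInvStep (d := d) Lc k)) Lc ν y' κ u
              * ((if y' = y then (1 / 2 : ℝ) else 0) - (if blk Lc u = y then (1 / 2 : ℝ) else 0))
              * ∑' xz : Site (d + 1) × Site (d + 1),
                  ((if xz.1 α % (Lc : ℤ) = (Lc : ℤ) - 1 then (1 : ℝ) else 0) * (if xz.2 β % (Lc : ℤ) = (Lc : ℤ) - 1 then (1 : ℝ) else 0))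
                    * SpureRecAt d Lc (toSite (ctrOff (d + 1) Lc)) cE cVH cΛ k κ u xz.1 xz.2 (Sum.inl α) (Sum.inl β))
          + ∑ ρ' : Fin (d + 1), ∑' w : Site (d + 1),
            colM (coDressKBmAt (toSite (ctrOff (d + 1) Lc)) Lc (KInvStep (d := d) Lc k)) Lc ν y' ρ' w
              * ((if y' = y then (1 / 2 : ℝ) else 0) - (if w = y then (1 / 2 : ℝ) else 0))
              * ∑' xz : Site (d + 1) × Site (d + 1),
                  ((if xz.1 α % (Lc : ℤ) = (Lc : ℤ) - 1 then (1 : ℝ) else 0) * (if xz.2 β % (Lc : ℤ) = (Lc : ℤ) - 1 then (1 : ℝ) else 0))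
                    * M1At d Lc (toSite (ctrOff (d + 1) Lc)) cΛ k ρ' w xz.1 xz.2 (Sum.inl α) (Sum.inl β)) := funext hVα
  have eQc : Qc = fun y' => (∑ κ : Fin (d + 1), ∑' u : Site (d + 1),
          (∑' x₂, ∑ κ₂, comp (coDressKBmAt (toSite (ctrOff (d + 1) Lc)) Lc (KInvStep (d := d) Lc k))
              (dM (coDressKBmAt (toSite (ctrOff (d + 1) Lc)) Lc (KInvStep (d := d) Lc k)) Lc (SpureRecAt d Lc (toSite (ctrOff (d + 1) Lc)) cE cVH cΛ k) (M1At d Lc (toSite (ctrOff (d + 1) Lc)) cΛ k) ν y')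
              u x₂ (Sum.inl κ) (Sum.inl κ₂) * gaugeWt Lc y κ₂ x₂)
            * ∑' xz : Site (d + 1) × Site (d + 1),
                ((if xz.1 α % (Lc : ℤ) = (Lc : ℤ) - 1 then (1 : ℝ) else 0) * (if xz.2 β % (Lc : ℤ) = (Lc : ℤ) - 1 then (1 : ℝ) else 0))
                  * SpureRecAt d Lc (toSite (ctrOff (d + 1) Lc)) cE cVH cΛ k κ u xz.1 xz.2 (Sum.inl α) (Sum.inl β)
        + ∑ ρ' : Fin (d + 1), ∑' w : Site (d + 1),
          (∑' x₂, ∑ κ₂, comp (coDressKBmAt (toSite (ctrOff (d + 1) Lc)) Lc (KInvStep (d := d) Lc k))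
              (dM (coDressKBmAt (toSite (ctrOff (d + 1) Lc)) Lc (KInvStep (d := d) Lc k)) Lc (SpureRecAt d Lc (toSite (ctrOff (d + 1) Lc)) cE cVH cΛ k) (M1At d Lc (toSite (ctrOff (d + 1) Lc)) cΛ k) ν y')
              ((Lc : ℤ) • w) x₂ (Sum.inr ρ') (Sum.inl κ₂) * gaugeWt Lc y κ₂ x₂)
            * ∑' xz : Site (d + 1) × Site (d + 1),
                ((if xz.1 α % (Lc : ℤ) = (Lc : ℤ) - 1 then (1 : ℝ) else 0) * (if xz.2 β % (Lc : ℤ) = (Lc : ℤ) - 1 then (1 : ℝ) else 0))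
                  * M1At d Lc (toSite (ctrOff (d + 1) Lc)) cΛ k ρ' w xz.1 xz.2 (Sum.inl α) (Sum.inl β)) := funext hQc
  set c : ℝ := stepScale d Lc k * (Lc : ℝ) ^ (d + 1) with hc
  -- the scalar is invertible
  have hc0 : c ≠ 0 := by
    have hL : (0 : ℝ) < Lc := by exact_mod_cast hLc1
    rw [hc, stepScale]
    positivity
  have hcc : c⁻¹ * c = 1 := inv_mul_cancel₀ hc0
  -- (W-γ)_k in the (S)-row form: the (γ) piece's profile `Qγ := −½·c⁻¹·Qc` is `−V⁺`
  set Qγ : Site (d + 1) → ℝ := fun e => -(1 / 2 : ℝ) * c⁻¹ * Qc e with hQγ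
  have hWγ : ∀ y', Qγ y' = (-1) * Vend y' := fun y' => by
    simp only [hQγ]
    rw [hW y']
    linear_combination (-(Vend y')) * hcc
  -- (INV-X-geo)_k: the (α) profile at the inverted slot is `−V⁺` (this seat, hypothesis-free at every level)
  have hgeo : ∀ y', Vα ((2 : ℕ) • y - Pi.single ν 1 - y') = (-1) * Vend y' := fun y' => by
    rw [hVα, hVend]
    exact weightedProfile_comb_slotInv_ctr_exit_level hLc cE cVH cΛ k y ν α β 1 1 y'
  -- hence the σ-pair's profile is slot-inversion invariant (road-P2's `slotInv_of_geo_of_ward`, `ε = −1`)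
  have hinv : ∀ y', (Vα ((2 : ℕ) • y - Pi.single ν 1 - y') - (1 / 2 : ℝ) * c⁻¹ * Qc ((2 : ℕ) • y - Pi.single ν 1 - y'))
      = Vα y' - (1 / 2 : ℝ) * c⁻¹ * Qc y' := fun y' => by
    have h := slotInv_of_geo_of_ward y ν (-1) hgeo hWγ y'
    simp only [hQγ] at h
    linear_combination h
  -- (M0)_α and the summable moments of the (α) profile (road-P2)
  have hα0 : HasSum Vα 0 := by
    rw [eVα]; exact hasSum_baseProfile_exit_level hLc1 hr cE cVH cΛ k y ν α β
  have hαm : ∀ lam, Summable fun y' => (((y' - y) lam : ℤ) : ℝ) * Vα y' := fun lam => by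
    rw [eVα]; exact summable_slotMoment_baseProfile_exit_level hLc1 hr cE cVH cΛ k y ν α β lam
  -- (M0)_γ and the envelope of the (γ) profile (leaf-06)
  have hω := abs_exitWt_le_one (Lc := Lc) (d := d) α β
  have hωp := exitWt_periodic (Lc := Lc) (d := d) α β
  have hγ0 : HasSum Qc 0 := by
    rw [eQc]; exact hasSum_comb_gaugeCharge_mass_zero hLc1 hr cE cVH cΛ k y ν (Sum.inl α) (Sum.inl β) hω hωp
  obtain ⟨B', δ', hδ', hb⟩ := exists_envelope_comb_gaugeCharge (d := d) hLc1 hr cE cVH cΛ k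
  have hγb : ∀ y', |Qc y'| ≤ B' * 1 * Real.exp (-δ' * l1 (y' - y)) := fun y' => by
    rw [hQc]; exact hb y ν (Sum.inl α) (Sum.inl β) _ 1 hω y'
  have hγm : ∀ lam, Summable fun y' => (((y' - y) lam : ℤ) : ℝ) * Qc y' := fun lam => summable_slotMoment_of_envelope hδ' hγb lam
  -- zero mass and summabilities of the pair
  have hZ0 : HasSum (fun y' => Vα y' - (1 / 2 : ℝ) * c⁻¹ * Qc y') 0 := by
    have h := hα0.sub (hγ0.mul_left ((1 / 2 : ℝ) * c⁻¹))
    rwa [mul_zero, sub_zero] at h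
  have hZm : ∀ lam, Summable fun y' => (((y' - y) lam : ℤ) : ℝ) * (Vα y' - (1 / 2 : ℝ) * c⁻¹ * Qc y') := fun lam => by
    have h := (hαm lam).sub ((hγm lam).mul_left ((1 / 2 : ℝ) * c⁻¹))
    refine h.congr fun y' => ?_
    ring
  refine ⟨hZ0.tsum_eq, fun lam => ?_⟩
  -- one involution, all first moments (the OWNER's parity lemma)
  exact tsum_mul_eq_zero_of_involutive (Equiv.subLeft ((2 : ℕ) • y - (Pi.single ν (1 : ℤ) : Site (d + 1)))) (κ := if lam = ν then 1 else 0)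
    (fun e => by rw [Equiv.subLeft_apply]; exact hinv e)
    (fun e => by rw [Equiv.subLeft_apply]; exact coord_slotInv y e ν lam)
    hZ0.summable (hZm lam) hZ0.tsum_eq

/-! ## §4 Level 0: (W-γ)₀ is leaf-06's FILE F — the (S) row for the exit⊗exit σ-pair with NO displayed hypothesis -/

/-- NOT IN PRINT; OUR BOOKKEEPING.  **THE (S) ROW AT LEVEL 0 FOR THE EXIT⊗EXIT σ-PAIR — NO DISPLAYED HYPOTHESIS** (profiles bound by their defining equations; centred root, `Lc` odd,
the residual tower's pin `cE = Lc^{d+1}` of `WardResidualSRecursionAll.exists_kernelLaws_vertexForm`, ALL `cVH cΛ`, `α ≠ β`, every `y ν`): the ω-charge profile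
`Z₀(y′) = Vα₀ y′ − ½·cH₀·Qc₀ y′` (`cH₀ = (stepScale_0·Lc^{d+1})⁻¹ = Lc^{−(d+1)}`) of the level-0 σ-pair `½ • (dM (conjV G₀ X_y) Lc S₀ M₀ − cH₀ • gauge-read₀)` has `Σ' Z₀ = 0` AND
`Σ' (y′ − y)_λ·Z₀(y′) = 0` for EVERY `λ` — §3 with (W-γ)₀ = leaf-06 g47 FILE F `gaugeCharge_exit_eq_two_mul_cE_mul_rotatedVertexEnd` (`Qc₀ = 2·cE·Vend₀`, `stepScale_0 = 1`). -/
theorem moments_sigmaPair_exit_levelZero (hLc : Odd Lc) {cE : ℝ} (hcE : cE = (Lc : ℝ) ^ (d + 1)) (cVH cΛ : ℝ) (y : Site (d + 1)) (ν : Fin (d + 1))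
    {α β : Fin (d + 1)} (hab : α ≠ β) {Vα Vend Qc : Site (d + 1) → ℝ}
    (hVα : ∀ y' : Site (d + 1), Vα y' =
        (1 / 2 : ℝ) *
          ((∑ κ : Fin (d + 1), ∑' u : Site (d + 1),
              colH (coDressKBmAt (toSite (ctrOff (d + 1) Lc)) Lc (KInvStep (d := d) Lc 0)) Lc ν y' κ u
                * ((if y' = y then (1 / 2 : ℝ) else 0) - (if blk Lc u = y then (1 / 2 : ℝ) else 0))
                * ∑' xz : Site (d + 1) × Site (d + 1),
                    ((if xz.1 α % (Lc : ℤ) = (Lc : ℤ) - 1 then (1 : ℝ) else 0) * (if xz.2 β % (Lc : ℤ) = (Lc : ℤ) - 1 then (1 : ℝ) else 0))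
                      * SpureRecAt d Lc (toSite (ctrOff (d + 1) Lc)) cE cVH cΛ 0 κ u xz.1 xz.2 (Sum.inl α) (Sum.inl β))
            + ∑ ρ' : Fin (d + 1), ∑' w : Site (d + 1),
              colM (coDressKBmAt (toSite (ctrOff (d + 1) Lc)) Lc (KInvStep (d := d) Lc 0)) Lc ν y' ρ' w
                * ((if y' = y then (1 / 2 : ℝ) else 0) - (if w = y then (1 / 2 : ℝ) else 0))
                * ∑' xz : Site (d + 1) × Site (d + 1),
                    ((if xz.1 α % (Lc : ℤ) = (Lc : ℤ) - 1 then (1 : ℝ) else 0) * (if xz.2 β % (Lc : ℤ) = (Lc : ℤ) - 1 then (1 : ℝ) else 0))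
                      * M1At d Lc (toSite (ctrOff (d + 1) Lc)) cΛ 0 ρ' w xz.1 xz.2 (Sum.inl α) (Sum.inl β)))
    (hVend : ∀ y' : Site (d + 1), Vend y' =
        (1 / 2 : ℝ) *
          ((∑ κ : Fin (d + 1), ∑' u : Site (d + 1),
              colH (coDressKBmAt (toSite (ctrOff (d + 1) Lc)) Lc (KInvStep (d := d) Lc 0)) Lc ν y' κ u
                * ((if y' + Pi.single ν 1 = y then (1 / 2 : ℝ) else 0) - (if blk Lc (u + Pi.single κ 1) = y then (1 / 2 : ℝ) else 0))
                * ∑' xz : Site (d + 1) × Site (d + 1),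
                    ((if xz.1 α % (Lc : ℤ) = (Lc : ℤ) - 1 then (1 : ℝ) else 0) * (if xz.2 β % (Lc : ℤ) = (Lc : ℤ) - 1 then (1 : ℝ) else 0))
                      * SpureRecAt d Lc (toSite (ctrOff (d + 1) Lc)) cE cVH cΛ 0 κ u xz.1 xz.2 (Sum.inl α) (Sum.inl β))
            + ∑ ρ' : Fin (d + 1), ∑' w : Site (d + 1),
              colM (coDressKBmAt (toSite (ctrOff (d + 1) Lc)) Lc (KInvStep (d := d) Lc 0)) Lc ν y' ρ' w
                * ((if y' + Pi.single ν 1 = y then (1 / 2 : ℝ) else 0) - (if w + Pi.single ρ' 1 = y then (1 / 2 : ℝ) else 0))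
                * ∑' xz : Site (d + 1) × Site (d + 1),
                    ((if xz.1 α % (Lc : ℤ) = (Lc : ℤ) - 1 then (1 : ℝ) else 0) * (if xz.2 β % (Lc : ℤ) = (Lc : ℤ) - 1 then (1 : ℝ) else 0))
                      * M1At d Lc (toSite (ctrOff (d + 1) Lc)) cΛ 0 ρ' w xz.1 xz.2 (Sum.inl α) (Sum.inl β)))
    (hQc : ∀ y' : Site (d + 1), Qc y' =
        (∑ κ : Fin (d + 1), ∑' u : Site (d + 1),
            (∑' x₂, ∑ κ₂, comp (coDressKBmAt (toSite (ctrOff (d + 1) Lc)) Lc (KInvStep (d := d) Lc 0))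
                (dM (coDressKBmAt (toSite (ctrOff (d + 1) Lc)) Lc (KInvStep (d := d) Lc 0)) Lc (SpureRecAt d Lc (toSite (ctrOff (d + 1) Lc)) cE cVH cΛ 0) (M1At d Lc (toSite (ctrOff (d + 1) Lc)) cΛ 0) ν y')
                u x₂ (Sum.inl κ) (Sum.inl κ₂) * gaugeWt Lc y κ₂ x₂)
              * ∑' xz : Site (d + 1) × Site (d + 1),
                  ((if xz.1 α % (Lc : ℤ) = (Lc : ℤ) - 1 then (1 : ℝ) else 0) * (if xz.2 β % (Lc : ℤ) = (Lc : ℤ) - 1 then (1 : ℝ) else 0))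
                    * SpureRecAt d Lc (toSite (ctrOff (d + 1) Lc)) cE cVH cΛ 0 κ u xz.1 xz.2 (Sum.inl α) (Sum.inl β)
          + ∑ ρ' : Fin (d + 1), ∑' w : Site (d + 1),
            (∑' x₂, ∑ κ₂, comp (coDressKBmAt (toSite (ctrOff (d + 1) Lc)) Lc (KInvStep (d := d) Lc 0))
                (dM (coDressKBmAt (toSite (ctrOff (d + 1) Lc)) Lc (KInvStep (d := d) Lc 0)) Lc (SpureRecAt d Lc (toSite (ctrOff (d + 1) Lc)) cE cVH cΛ 0) (M1At d Lc (toSite (ctrOff (d + 1) Lc)) cΛ 0) ν y')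
                ((Lc : ℤ) • w) x₂ (Sum.inr ρ') (Sum.inl κ₂) * gaugeWt Lc y κ₂ x₂)
              * ∑' xz : Site (d + 1) × Site (d + 1),
                  ((if xz.1 α % (Lc : ℤ) = (Lc : ℤ) - 1 then (1 : ℝ) else 0) * (if xz.2 β % (Lc : ℤ) = (Lc : ℤ) - 1 then (1 : ℝ) else 0))
                    * M1At d Lc (toSite (ctrOff (d + 1) Lc)) cΛ 0 ρ' w xz.1 xz.2 (Sum.inl α) (Sum.inl β))) :
    (∑' y' : Site (d + 1), (Vα y' - (1 / 2 : ℝ) * (stepScale d Lc 0 * (Lc : ℝ) ^ (d + 1))⁻¹ * Qc y') = 0)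
      ∧ ∀ lam : Fin (d + 1),
        ∑' y' : Site (d + 1), (((y' - y) lam : ℤ) : ℝ) * (Vα y' - (1 / 2 : ℝ) * (stepScale d Lc 0 * (Lc : ℝ) ^ (d + 1))⁻¹ * Qc y') = 0 := by
  refine moments_sigmaPair_exit_of_ward_level hLc cE cVH cΛ 0 y ν α β hVα hVend hQc fun y' => ?_
  have h0 : stepScale d Lc 0 = 1 := by rw [stepScale, pow_zero, one_pow]
  rw [hQc, hVend, h0, one_mul, ← hcE]
  exact gaugeCharge_exit_eq_two_mul_cE_mul_rotatedVertexEnd (ctrOff_mem_box hLc.pos) hab cE cVH cΛ ν y' y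

/-- NOT IN PRINT; OUR BOOKKEEPING.  **THE SAME, LITERALLY: ALL FIRST SLOT-MOMENTS OF THE LEVEL-0 σ-PAIR's EXIT⊗EXIT CHARGE PROFILE VANISH** (centred root, `Lc` odd,
`cE = Lc^{d+1}`, all `cVH cΛ`, `α ≠ β`, every `y ν λ`; the profile written out — no binder left to instantiate). -/
theorem tsum_slotMoment_sigmaPair_exit_levelZero (hLc : Odd Lc) {cE : ℝ} (hcE : cE = (Lc : ℝ) ^ (d + 1)) (cVH cΛ : ℝ) (y : Site (d + 1)) (ν : Fin (d + 1))
    {α β : Fin (d + 1)} (hab : α ≠ β) (lam : Fin (d + 1)) :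
    ∑' y' : Site (d + 1), (((y' - y) lam : ℤ) : ℝ) *
        ((1 / 2 : ℝ) *
          ((∑ κ : Fin (d + 1), ∑' u : Site (d + 1),
              colH (coDressKBmAt (toSite (ctrOff (d + 1) Lc)) Lc (KInvStep (d := d) Lc 0)) Lc ν y' κ u
                * ((if y' = y then (1 / 2 : ℝ) else 0) - (if blk Lc u = y then (1 / 2 : ℝ) else 0))
                * ∑' xz : Site (d + 1) × Site (d + 1),
                    ((if xz.1 α % (Lc : ℤ) = (Lc : ℤ) - 1 then (1 : ℝ) else 0) * (if xz.2 β % (Lc : ℤ) = (Lc : ℤ) - 1 then (1 : ℝ) else 0))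
                      * SpureRecAt d Lc (toSite (ctrOff (d + 1) Lc)) cE cVH cΛ 0 κ u xz.1 xz.2 (Sum.inl α) (Sum.inl β))
            + ∑ ρ' : Fin (d + 1), ∑' w : Site (d + 1),
              colM (coDressKBmAt (toSite (ctrOff (d + 1) Lc)) Lc (KInvStep (d := d) Lc 0)) Lc ν y' ρ' w
                * ((if y' = y then (1 / 2 : ℝ) else 0) - (if w = y then (1 / 2 : ℝ) else 0))
                * ∑' xz : Site (d + 1) × Site (d + 1),
                    ((if xz.1 α % (Lc : ℤ) = (Lc : ℤ) - 1 then (1 : ℝ) else 0) * (if xz.2 β % (Lc : ℤ) = (Lc : ℤ) - 1 then (1 : ℝ) else 0))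
                      * M1At d Lc (toSite (ctrOff (d + 1) Lc)) cΛ 0 ρ' w xz.1 xz.2 (Sum.inl α) (Sum.inl β))
          - (1 / 2 : ℝ) * (stepScale d Lc 0 * (Lc : ℝ) ^ (d + 1))⁻¹ *
            (∑ κ : Fin (d + 1), ∑' u : Site (d + 1),
                (∑' x₂, ∑ κ₂, comp (coDressKBmAt (toSite (ctrOff (d + 1) Lc)) Lc (KInvStep (d := d) Lc 0))
                    (dM (coDressKBmAt (toSite (ctrOff (d + 1) Lc)) Lc (KInvStep (d := d) Lc 0)) Lc (SpureRecAt d Lc (toSite (ctrOff (d + 1) Lc)) cE cVH cΛ 0) (M1At d Lc (toSite (ctrOff (d + 1) Lc)) cΛ 0) ν y')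
                    u x₂ (Sum.inl κ) (Sum.inl κ₂) * gaugeWt Lc y κ₂ x₂)
                  * ∑' xz : Site (d + 1) × Site (d + 1),
                      ((if xz.1 α % (Lc : ℤ) = (Lc : ℤ) - 1 then (1 : ℝ) else 0) * (if xz.2 β % (Lc : ℤ) = (Lc : ℤ) - 1 then (1 : ℝ) else 0))
                        * SpureRecAt d Lc (toSite (ctrOff (d + 1) Lc)) cE cVH cΛ 0 κ u xz.1 xz.2 (Sum.inl α) (Sum.inl β)
              + ∑ ρ' : Fin (d + 1), ∑' w : Site (d + 1),
                (∑' x₂, ∑ κ₂, comp (coDressKBmAt (toSite (ctrOff (d + 1) Lc)) Lc (KInvStep (d := d) Lc 0))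
                    (dM (coDressKBmAt (toSite (ctrOff (d + 1) Lc)) Lc (KInvStep (d := d) Lc 0)) Lc (SpureRecAt d Lc (toSite (ctrOff (d + 1) Lc)) cE cVH cΛ 0) (M1At d Lc (toSite (ctrOff (d + 1) Lc)) cΛ 0) ν y')
                    ((Lc : ℤ) • w) x₂ (Sum.inr ρ') (Sum.inl κ₂) * gaugeWt Lc y κ₂ x₂)
                  * ∑' xz : Site (d + 1) × Site (d + 1),
                      ((if xz.1 α % (Lc : ℤ) = (Lc : ℤ) - 1 then (1 : ℝ) else 0) * (if xz.2 β % (Lc : ℤ) = (Lc : ℤ) - 1 then (1 : ℝ) else 0))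
                        * M1At d Lc (toSite (ctrOff (d + 1) Lc)) cΛ 0 ρ' w xz.1 xz.2 (Sum.inl α) (Sum.inl β))) = 0 :=
  (moments_sigmaPair_exit_levelZero hLc hcE cVH cΛ y ν hab (Vend := fun y' => (1 / 2 : ℝ) *
        ((∑ κ : Fin (d + 1), ∑' u : Site (d + 1),
            colH (coDressKBmAt (toSite (ctrOff (d + 1) Lc)) Lc (KInvStep (d := d) Lc 0)) Lc ν y' κ u
              * ((if y' + Pi.single ν 1 = y then (1 / 2 : ℝ) else 0) - (if blk Lc (u + Pi.single κ 1) = y then (1 / 2 : ℝ) else 0))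
              * ∑' xz : Site (d + 1) × Site (d + 1),
                  ((if xz.1 α % (Lc : ℤ) = (Lc : ℤ) - 1 then (1 : ℝ) else 0) * (if xz.2 β % (Lc : ℤ) = (Lc : ℤ) - 1 then (1 : ℝ) else 0))
                    * SpureRecAt d Lc (toSite (ctrOff (d + 1) Lc)) cE cVH cΛ 0 κ u xz.1 xz.2 (Sum.inl α) (Sum.inl β))
          + ∑ ρ' : Fin (d + 1), ∑' w : Site (d + 1),
            colM (coDressKBmAt (toSite (ctrOff (d + 1) Lc)) Lc (KInvStep (d := d) Lc 0)) Lc ν y' ρ' w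
              * ((if y' + Pi.single ν 1 = y then (1 / 2 : ℝ) else 0) - (if w + Pi.single ρ' 1 = y then (1 / 2 : ℝ) else 0))
              * ∑' xz : Site (d + 1) × Site (d + 1),
                  ((if xz.1 α % (Lc : ℤ) = (Lc : ℤ) - 1 then (1 : ℝ) else 0) * (if xz.2 β % (Lc : ℤ) = (Lc : ℤ) - 1 then (1 : ℝ) else 0))
                    * M1At d Lc (toSite (ctrOff (d + 1) Lc)) cΛ 0 ρ' w xz.1 xz.2 (Sum.inl α) (Sum.inl β)))
    (fun _ => rfl) (fun _ => rfl) (fun _ => rfl)).2 lam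

end Summit.QuantumFields.BalabanUV.Beta.GAN24.SigmaPairSlotMomentsExit

end
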